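import Literature.Geometry.Lorentzian.SchwarzschildKerrSchildComponents

/-!
# Route EIHFluxBalance — `InertialRecession` (E′), K1 / stub `stub_coerMomKernel` (Bk), far field, part F3a:
# the derivative of the Lense–Thirring (spin-dipole) atom in closed form

Helper file for the crux `stmt-FinalStateConjecture-17403`. The linearised spin term of Kerr–Schild Kerr with spin vector
`σ` is `k_LT(σ)(U,W) = (2/r³)(ℓ(U) τ_σ(W) + τ_σ(U) ℓ(W))`, `τ_σ(U) = (x⃗ × σ)·U⃗ = ⟪x⃗, c_σ(U)⟫` with the constant vector
`c_σ(U) = U⃗ × … ` — we only use that `τ_σ(U) = sdot x c` for a constant `c`; for `σ = e₃`, `M = 1` this is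
`Kerr.spinMetric` (`spinMetric_zero_eq`). Here: the derivative of the scalar atom
`y ↦ (2/r³)(ℓ_y(U) ⟪y⃗,c_W⟫ + ⟪y⃗,c_U⟫ ℓ_y(W))` along `E` in closed form (`fderiv_ltAtom_apply`) and its differentiability.
No definitions, no `sorry`. [folklore]
-/

set_option linter.dupNamespace false

noncomputable section

-- instance search through the nested operator types (as in `SchwarzschildKerrSchildComponents`)
set_option maxSynthPendingDepth 3

open scoped Topology InnerProductSpace
open Filter Set Function Literature.Geometry.Lorentzian Literature.Geometry.Lorentzian.Schwarzschild

namespace Summit.FinalStateConjecture.FinalStateConjecture.Theorems.SublinearIsFree.Slaving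

variable {x : E4}

/-- The Lense–Thirring atom is differentiable off the time axis (with the displayed derivative). [folklore] -/
theorem hasFDerivAt_ltAtom (hx : E4.spatial x ≠ 0) (U W cU cW : E4) :
    HasFDerivAt (fun y : E4 ↦ 2 / E4.spatialNorm y ^ 3 * (ell y U * sdot y cW + sdot y cU * ell y W))
      ((2 / E4.spatialNorm x ^ 3) • ((ell x U • sdotCLM cW + sdot x cW • ellFD x U) +
          (sdot x cU • ellFD x W + ell x W • sdotCLM cU)) +
        (ell x U * sdot x cW + sdot x cU * ell x W) • ((-(2 * (3 : ℕ)) / E4.spatialNorm x ^ (3 + 2)) • sdotCLM x)) x :=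
  (hasFDerivAt_const_div_spatialNorm_pow 2 hx 3).mul
    (((hasFDerivAt_ell hx U).mul (hasFDerivAt_sdot_left x cW)).add
      ((hasFDerivAt_sdot_left x cU).mul (hasFDerivAt_ell hx W)))

/-- **The derivative of the Lense–Thirring atom** off the time axis:
`∂_E[(2/r³)(ℓ(U)⟪y⃗,c_W⟫ + ⟪y⃗,c_U⟫ℓ(W))] = −(6/r⁵)⟪x⃗,E⃗⟫(ℓ(U)⟪x⃗,c_W⟫ + ⟪x⃗,c_U⟫ℓ(W))
  + (2/r³)(∂_Eℓ(U)⟪x⃗,c_W⟫ + ℓ(U)⟪c_W,E⃗⟫ + ⟪c_U,E⃗⟫ℓ(W) + ⟪x⃗,c_U⟫∂_Eℓ(W))`. [folklore] -/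
theorem fderiv_ltAtom_apply (hx : E4.spatial x ≠ 0) (U W cU cW E : E4) :
    fderiv ℝ (fun y : E4 ↦ 2 / E4.spatialNorm y ^ 3 * (ell y U * sdot y cW + sdot y cU * ell y W)) x E =
      -(6 / E4.spatialNorm x ^ 5) * sdot x E * (ell x U * sdot x cW + sdot x cU * ell x W) +
        2 / E4.spatialNorm x ^ 3 *
          (dEll x E U * sdot x cW + ell x U * sdot cW E + sdot cU E * ell x W + sdot x cU * dEll x E W) := by
  have hr : E4.spatialNorm x ≠ 0 := by rwa [E4.spatialNorm, norm_ne_zero_iff]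
  rw [(hasFDerivAt_ltAtom hx U W cU cW).fderiv]
  simp only [FunLike.coe_add, Pi.add_apply, FunLike.coe_smul, Pi.smul_apply, sdotCLM_apply, ellFD_apply,
    smul_eq_mul]
  push_cast
  ring

/-- Registered carrier `slaving_farFieldSpinAtom_slaving12` of the crux item (= `fderiv_ltAtom_apply`). [folklore] -/
theorem slaving_farFieldSpinAtom_slaving12 : open Literature.Geometry.Lorentzian Literature.Geometry.Lorentzian.Schwarzschild in ∀ {x : E4}, E4.spatial x ≠ 0 → ∀ U W cU cW E : E4, fderiv ℝ (fun y : E4 ↦ 2 / E4.spatialNorm y ^ 3 * (ell y U * sdot y cW + sdot y cU * ell y W)) x E = -(6 / E4.spatialNorm x ^ 5) * sdot x E * (ell x U * sdot x cW + sdot x cU * ell x W) + 2 / E4.spatialNorm x ^ 3 * (dEll x E U * sdot x cW + ell x U * sdot cW E + sdot cU E * ell x W + sdot x cU * dEll x E W) :=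
  fun hx U W cU cW E ↦ fderiv_ltAtom_apply hx U W cU cW E

end Summit.FinalStateConjecture.FinalStateConjecture.Theorems.SublinearIsFree.Slaving
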